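import Summits.Ventures.GridStability.Models.GFMSMIBTwinCSACCT
import Summits.Ventures.GridStability.Models.GFMSMIBTwinVIRelease

/-!
# GridStability/Models/GFMSMIBTwinCSARelease — the twin with its current saturation RELEASED at the printed crossing (or at any instant with non-negative converter angle): every bolted fault of duration ≤ 0.24 s is recovered to `(δˢ, 0)` (phases 3–4 of Qoria's Fig. V-14 with inertial effect), 0 kit

Cell `gridfusion` (LADDER-GRIDFUSION rung G3.a; seat gridfusion-model-3 (g10)); companion of `GFMSMIBTwinCSACCT.lean`
(`twinSAT_cct_lower`: for `T ≤ 6/25` s the CSA-LATCHED post-fault motion stays in the saturated-branch energy well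
`{V_SAT ≤ 1}`).  In the print the converter leaves the saturated branch at the crossing point (d) of Fig. V-14
(`P_max sin δ = P_max3 cos δ`, `δ_d = arctan(3/10) > 0`) on its way back [cite: Qoria2020, §V.3.3 Fig. V-14 phases
3–4].  THIS FILE certifies the recovery with the release instant as an INPUT restricted only by «converter angle
`≥ 0` at release» (true at the printed crossing): for every `T ≤ 6/25` s and every `t_d ≥ 0` with
`(Y t_d).1 ≥ π/2` (shifted angle), the motion that follows the saturated branch until `t_d` and the unlimited twin
from `Y t_d − (π/2, 0)` on keeps the unlimited window, energy `≤ 6.4917`, and tends to `(δˢ, 0)`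
(`twinSAT_release_returns`).  KEY LEMMA `unl_energy_le_of_sat_well`: on `{V_SAT ≤ 1} ∩ {π/2 ≤ δ′ < π − δ′₁}` the
shifted angle is `≤ 5/2` (`V_PE,SAT(5/2) > 1`), so the converter angle lies in `[0, 0.93]`, where the unlimited
energy is `≤ 1 + g_max + 4c* ≤ 2.3 < 6.4917 < V_cr` (`g(δ) = −p*′(δ − δˢ) − 4 cos δ ≤ −27/10` on `[0, 0.93]`).
THREE COLUMNS.  CERTIFIED: «MODEL M_twin+CSA→M_twin (saturated branch on `[0, t_d]`, unlimited after, any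
`t_d ≥ 0` at which the converter angle is `≥ 0`; bolted terminal fault from `(δˢ, 0)`; MV-6D + MV-P + MV-Ω +
P-INV-7): every fault cleared at `T ≤ 0.24` s is recovered to `(δˢ, 0)`».  VALIDATED: RK4 `0.296 s` with the
printed release rule.  MODELLED: the release instant is the real limiter's ((V-22) exit at (d)), outside the
model; a release at a NEGATIVE converter angle (the latched motion swings down to `−2.46` rad in the MODEL) is
not covered and not claimed; nothing about a device.
-/

noncomputable section

open Real Set Filter Topology
open Summit.Ventures.GridStability.Models.AngleEnclosure

namespace Summit.Ventures.GridStability.Models.SMIB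

open InverterDroop

/-- **KEY LEMMA.**  On the saturated-branch window, right of `π/2`, with `V_SAT ≤ 1`: the converter angle
`δ = δ′ − π/2` lies in `[0, 5/2 − π/2] ⊂ (−π − δˢ, π − δˢ)` and the UNLIMITED twin energy is `≤ 6.4917`. [folklore] -/
theorem unl_energy_le_of_sat_well {d w : ℝ} (hwin : d ∈ Ioo (-π - twinSAT_δ1) (π - twinSAT_δ1))
    (hpos : π / 2 ≤ d) (hV : gfmQoriaV5sSAT.energy twinSAT_δ1 (d, w) ≤ 1) :
    d - π / 2 ∈ Ioo (-π - deltaQV4) (π - deltaQV4) ∧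
      gfmQoriaV5sPhys.energy deltaQV4 (d - π / 2, w) ≤ 64917 / 10000 := by
  set p := gfmQoriaV5sSAT.toLit with hp
  have hpv : p = ⟨113 / 3550, 113 / 1420, 8290560 / 16581121, 6 / 5⟩ := gfmQoriaV5sSAT_toLit
  obtain ⟨hd1, hd2⟩ := twinSAT_δ1_bounds
  obtain ⟨hc1, hc2⟩ := cos_twinSAT_δ1_bounds
  have hδs1 := deltaQV4_gt
  have hδs2 := deltaQV4_lt
  have hπ1 := pi_gt_d6
  have hπ2 := pi_lt_d6
  norm_num at hπ1 hπ2
  have heq : p.IsEquilibriumAngle twinSAT_δ1 :=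
    (toLit_isEquilibriumAngle_iff gfmQoriaV5sSAT_γ twinSAT_δ1).2 gfmQoriaV5sSAT_isEquilibrium
  have hmonoArc := p.potentialEnergy_monotoneOn_arc (by rw [hpv]; norm_num) heq twinSAT_δ1_mem.1.le
    twinSAT_δ1_mem.2.le
  -- split the saturated energy; the potential is ≥ 0 right of δ′₁
  have hE : gfmQoriaV5sSAT.energy twinSAT_δ1 (d, w)
      = (113 : ℝ) / 3550 * w ^ 2 / 2 + p.potentialEnergy twinSAT_δ1 d := by
    rw [← toLit_energy gfmQoriaV5sSAT_γ, ← hp]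
    unfold Literature.MathematicalPhysics.PowerSystems.SMIB.energy
    rw [hpv]; ring
  rw [hE] at hV
  have h0 : p.potentialEnergy twinSAT_δ1 twinSAT_δ1 = 0 := p.potentialEnergy_self twinSAT_δ1
  have hpot0 : 0 ≤ p.potentialEnergy twinSAT_δ1 d := by
    have := hmonoArc ⟨le_rfl, by linarith⟩ ⟨by linarith, hwin.2.le⟩ (by linarith : twinSAT_δ1 ≤ d)
    linarith
  have hKE : (113 : ℝ) / 3550 * w ^ 2 / 2 ≤ 1 := by linarith
  have hpot : p.potentialEnergy twinSAT_δ1 d ≤ 1 := by nlinarith [sq_nonneg w]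
  -- fence: V_PE,SAT(5/2) > 1 ⇒ d ≤ 5/2
  have hright : d ≤ 5 / 2 := by
    by_contra hlt
    push Not at hlt
    have hmono := hmonoArc (show (5 / 2 : ℝ) ∈ Icc twinSAT_δ1 (π - twinSAT_δ1) from
        ⟨by linarith, by linarith⟩) ⟨by linarith, hwin.2.le⟩ hlt.le
    have hcos : cos (5 / 2 : ℝ) ≤ cosUpper4 (5 / 2) :=
      cos_le_cosUpper4 (by norm_num) (by linarith [pi_gt_three])
    rw [hpv] at hmono
    unfold Literature.MathematicalPhysics.PowerSystems.SMIB.potentialEnergy at hmono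
    rw [hpv] at hpot
    unfold Literature.MathematicalPhysics.PowerSystems.SMIB.potentialEnergy at hpot
    norm_num [dbl, cosUpper4] at hcos hmono hpot
    nlinarith [hcos, hc1, hd1]
  have hδlo : 0 ≤ d - π / 2 := by linarith
  have hδhi : d - π / 2 ≤ 9293 / 10000 := by linarith
  refine ⟨⟨by linarith [pi_gt_three], by linarith [pi_gt_three]⟩, ?_⟩
  -- the unlimited potential g(δ) = −p*′(δ − δˢ) − 4 cos δ ≤ −27/10 on [0, 0.9293]
  have hpotU : -(8290560 / 16581121 : ℝ) * (d - π / 2 - deltaQV4) - 4 * cos (d - π / 2) ≤ -(27 / 10) := by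
    rcases le_total (d - π / 2) deltaQV4 with hle | hge
    · have hanti := qv4_potential_antitoneOn (show (0 : ℝ) ∈ Icc (-1) deltaQV4 from
        ⟨by norm_num, deltaQV4_pos.le⟩) ⟨by linarith, hle⟩ hδlo
      simp only at hanti
      refine hanti.trans ?_
      rw [cos_zero]
      norm_num at hδs2 ⊢; nlinarith
    · have hmono := qv4_potential_monotoneOn ⟨hge, by linarith [pi_gt_three]⟩
        (show (9293 / 10000 : ℝ) ∈ Icc deltaQV4 (π - deltaQV4) from ⟨by linarith, by linarith [pi_gt_three]⟩)
        hδhi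
      simp only at hmono
      refine hmono.trans ?_
      have hcos : cosLower4 (9293 / 10000) ≤ cos (9293 / 10000 : ℝ) :=
        cosLower4_le_cos _ (by norm_num [dbl]) (by norm_num [dbl]) (by norm_num [dbl]) (by norm_num [dbl])
      norm_num [dbl, cosLower4] at hcos hδs1 ⊢
      nlinarith
  simp only [energy, gfmQoriaV5sPhys, sub_zero, cos_deltaQV4]
  norm_num [cQV4] at hpotU ⊢
  nlinarith [hKE, hpotU]

/-- **CSA released at any instant with non-negative converter angle: recovery to `(δˢ, 0)` for every fault of
duration `T ≤ 6/25` s.**  `Y` is the CSA-latched post-fault motion from the shifted fault-on state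
(`GFMSMIBTwinCSACCT`), `t_d ≥ 0` a release instant with `(Y t_d).1 ≥ π/2` (converter angle `≥ 0`, as at the printed
crossing (d), `δ_d = arctan(3/10)`), `X` the unlimited twin's motion from `Y t_d − (π/2, 0)`: `X` keeps
`δ ∈ (−π − δˢ, π − δˢ)` and energy `≤ 6.4917` for ever and tends to `(δˢ, 0)`.  MODELLED: M_twin+CSA→M_twin; nothing
about a device. [cite: Qoria2020, §V.3.3 Fig. V-14 (phases 3–4), §V.3.6] -/
theorem twinSAT_release_returns {T : ℝ} (hT0 : 0 ≤ T) (hT : T ≤ 6 / 25) {Y : ℝ → ℝ × ℝ}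
    (hY : gfmQoriaV5sSAT.IsSolutionOn Y (Ici 0))
    (hY0 : Y 0 = ((twinFaultOnState T).1 + π / 2, (twinFaultOnState T).2))
    {td : ℝ} (htd : 0 ≤ td) (hrel : π / 2 ≤ (Y td).1) {X : ℝ → ℝ × ℝ}
    (hX : gfmQoriaV5sPhys.IsSolutionOn X (Ici 0)) (hX0 : X 0 = ((Y td).1 - π / 2, (Y td).2)) :
    (∀ t, 0 ≤ t → (X t).1 ∈ Ioo (-π - deltaQV4) (π - deltaQV4) ∧
        gfmQoriaV5sPhys.energy deltaQV4 (X t) ≤ 64917 / 10000) ∧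
      Tendsto X atTop (𝓝 (deltaQV4, 0)) := by
  obtain ⟨hinv, -⟩ := twinSAT_cct_lower hT0 hT hY hY0
  obtain ⟨hwin, hV⟩ := hinv td htd
  obtain ⟨hwin', hV'⟩ := unl_energy_le_of_sat_well (w := (Y td).2) hwin hrel hV
  refine energyWell_roa_Ici (p := gfmQoriaV5sPhys) rfl (by norm_num [gfmQoriaV5sPhys])
    (by norm_num [gfmQoriaV5sPhys]) (by norm_num [gfmQoriaV5sPhys]) gfmQoriaV5sPhys_isEquilibrium
    deltaQV4_pos.le deltaQV4_lt_pi_div_two twin_criticalEnergy_gt hX ?_ ?_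
  · rw [hX0]; exact hwin'
  · rw [hX0]; exact hV'

end Summit.Ventures.GridStability.Models.SMIB

end
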